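import Literature.AlgebraicGeometry.AbelianSchemes.AbelianLiftOfIsUnitTwo
import HarnessLib

/-!
# Abelian schemes lift along `A → A⧸J₀` (`A` Artinian local, `2 ∈ A^×`) under the `H¹`-count for the ONE canonical closed fibre `X₀ ⊗ κ(A)`
# ([Oort1971] Thm. (2.2.1), first proof, PER INSTANCE; [StacksProject] 02KH; [MumfordAV1970] §13 Cor. 2)

Layer `Literature/AlgebraicGeometry/AbelianSchemes`, namespace `Literature.AlgebraicGeometry.AbelianSchemes.AbelianSchemeOver`.
PROOF FILE (cell `hodgecm-mathlib`, P6 «MOD programme» sub-desk P6b, (U-ab) plate organ **(O8) «ABELIAN LIFT WHEN 2 IS A UNIT, PER INSTANCE»**, desk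
F0P6b-plan (g10) design (CENSUS-hH1-charp v1 §4) ∕ (g11) text; count-neutral ★ capital on `--supports stmt-HodgeConjecture-24832`; THEOREMS ONLY: no
definition, no instance, no notation, no named fact, no `sorry`).

THE POINT.  ★ (O7) `exists_abelianLift_of_isUnit_two` ([Oort1971] (2.2.1) with `2 ∈ A^×`) takes the `H¹`-count `dim B ≤ dim_k Ȟ¹(𝔙, 𝒪_B) + 1` for EVERY
abelian scheme `B` over EVERY field, because ★ FC-4 `exists_abelianLift_of_liftObstructionVanishes` quantifies its rung hypothesis over all abelian `Y₀` at
every principal small rung.  But the rungs of the lift of a GIVEN `X₀ → Spec (A⧸J₀)` only meet LIFTS `Y₀` OF `X₀`, and the canonical closed fibre of such a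
`Y₀` (over `κ(A⧸J′)`) is the base change of the canonical closed fibre `X₀ ⊗ κ(A)` along the residue-field ISOMORPHISM `κ(A) → κ(A⧸J′)`; Čech `Ȟ¹(𝒪)`
commutes with this flat base change ([StacksProject] 02KH in degree one, ★ `Morphisms.finrank_cechH1_baseChange`) and its rank does not depend on the finite
affine cover ([Hartshorne1977] III 4.5, ★ `Morphisms.finrank_cechH1_eq_of_isAffineOpen`).  HENCE the count is needed for `X₀ ⊗ κ(A)` ALONE:
* §A  FC-3′ `exists_abelianLift_of_rungs_of_lifts`, FC-4′ `exists_abelianLift_of_liftObstructionVanishes_of_lifts` — ★ FC-3 ∕ FC-4 with the rung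
      hypothesis asked only of the lifts of `X₀` (those `Y₀` receiving a base-change square `G₀ : X₀ → Y₀` over `Spec ((A⧸J′)⧸(J∕J′) ≅ A⧸J → A⧸J₀)`);
      proofs = the ★ proofs with the square threaded through ★ `descent_on_principalSmall`.
* §B  `specMap_residueFieldMap_comp_residueBaseMap_comp` (the residue points of a rung agree) and **(T) `closedFibreCount_of_isBaseChangeVia`** — the
      count passes from `X₀ ⊗ κ(A)` to `Y₀ ⊗ κ(A⧸J′)` (pullback pasting ∕ cancellation of the three cartesian squares, `IsPullback.paste_horiz` ∕ `lift` ∕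
      `of_right`; ★ `finrank_cechH1_baseChange`; Mathlib `Module.finrank_baseChange`; ★ `finrank_cechH1_eq_of_isAffineOpen`; `dim = g` on both fibres, ★
      `dim_toAffine_toAbelianVariety_of_isOfRelDim`).
* §C  **(O8a) `exists_abelianLift_of_isUnit_two_of_closedFibreCount`** — [Oort1971] (2.2.1) with `2 ∈ A^×` for `X₀` of relative dimension `g` over
      `Spec (A⧸J₀)`, `J₀ ≠ ⊤`, under the count for `X₀ ⊗ κ(A)` on every finite affine open cover (:= FC-4′ ∘ ★ (O6) `liftObstructionVanishes_of_isUnit_two`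
      ∘ (T)); **(O8b) `exists_abelianLift_of_isUnit_two_of_closedFibreCount_one`** — the same with `g ≤ dim_{κ(A)} Ȟ¹(𝔙, 𝒪) + 1` on ONE finite affine open
      cover.  HONEST LABEL: conditional on that one count ([MumfordAV1970] §13 Cor. 2 gives `dim_k H¹(B, 𝒪_B) = dim B`; ★ in residue characteristic `0` and
      ★ for DUALS-letter data — sequel ★ `AbelianLiftOfClosedFibreLetter` is UNCONDITIONAL in that regime —; OPEN in the tree for a bare abelian variety in
      characteristic `p`).  The banked socket `F0P6bBTSerreTate.stub_L4B1u_abelianLiftOfIsUnitTwo` is universally quantified and is NOT paid by this file.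

HC_CM is proved only modulo the printed citations (2 remaining named inputs) until rung 0 closes; nothing here bears on a summit statement.
## References
* [Oort1971] F. Oort, *Finite group schemes, local moduli for abelian varieties, and lifting problems*, Compositio Math. 23 (1971), Thm. (2.2.1)
  (p. 273) and its first proof (pp. 277–280).
* [MumfordFogartyKirwan1994] D. Mumford, J. Fogarty, F. Kirwan, *Geometric Invariant Theory*, 3rd ed. (1994), Ch. 6 §3 Proposition 6.15 (p. 124).
* [MumfordAV1970] D. Mumford, *Abelian Varieties* (1970), §13 Cor. 2 (p. 129).
* [StacksProject] The Stacks Project, Tag 02KH (Cohomology of Schemes, Lemma 30.5.2: flat base change), Tag 06GE (small extensions).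
* [Hartshorne1977] R. Hartshorne, *Algebraic Geometry* (1977), III Prop. 9.3 (p. 255), III Thm. 4.5 (p. 222).
* [GortzWedhorn2020] U. Görtz, T. Wedhorn, *Algebraic Geometry I*, 2nd ed. (2020), Section (4.7) (pp. 107–108) (fibres and base change).
-/

noncomputable section

set_option backward.isDefEq.respectTransparency false

open CategoryTheory CategoryTheory.Limits AlgebraicGeometry IsLocalRing
open Literature.AlgebraicGeometry.Morphisms

universe u

namespace Literature.AlgebraicGeometry.AbelianSchemes.AbelianSchemeOver

open Literature.RingTheory.Artinian

/-! ## §A FC-3′ ∕ FC-4′ — the flag of principal small rungs, threaded through the lifts of `X₀` -/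

/-- **FC-3′ — PER-INSTANCE descent on principal small rungs** (★ FC-3 `exists_abelianLift_of_rungs` with `hstep` asked only of lifts of `X₀`).
[cite: Oort1971, Theorem (2.2.1) (p. 273), first proof (pp. 279–280)] [cite: StacksProject, Tag 06GE] -/
theorem exists_abelianLift_of_rungs_of_lifts {A : Type u} [CommRing A] [IsArtinianRing A] [IsLocalRing A] (J₀ : Ideal A) {g : ℕ}
    (X₀ : AbelianSchemeOver (Spec (.of (A ⧸ J₀)))) (hg : X₀.IsOfRelDim g)
    (hstep : ∀ ⦃J J' : Ideal A⦄ (t : A) (hJJ₀ : J ≤ J₀) (hJ'J : J' < J) (_ : IsLocalRing.maximalIdeal A * J ≤ J') (_ : t ∈ J) (_ : t ∉ J')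
      (_ : J' ⊔ Ideal.span {t} = J) (Y₀ : AbelianSchemeOver (Spec (.of (A ⧸ J)))), Y₀.IsOfRelDim g →
      ∀ (G₀ : X₀.X.left ⟶ Y₀.X.left), X₀.IsBaseChangeVia Y₀ (Spec.map (CommRingCat.ofHom (Ideal.Quotient.factor hJJ₀))) G₀ →
        ∃ (Y : AbelianSchemeOver (Spec (.of (A ⧸ J')))) (_ : Y.IsOfRelDim g) (G : Y₀.X.left ⟶ Y.X.left),
          Y₀.IsBaseChangeVia Y (Spec.map (CommRingCat.ofHom (Ideal.Quotient.factor hJ'J.le))) G) :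
    ∃ (X : AbelianSchemeOver (Spec (.of A))) (_ : X.IsOfRelDim g) (G : X₀.X.left ⟶ X.X.left),
      X₀.IsBaseChangeVia X (Spec.map (CommRingCat.ofHom (Ideal.Quotient.mk J₀))) G := by
  have hbot : ∀ h : (⊥ : Ideal A) ≤ J₀, ∃ (Y : AbelianSchemeOver (Spec (.of (A ⧸ (⊥ : Ideal A))))) (_ : Y.IsOfRelDim g)
      (G : X₀.X.left ⟶ Y.X.left), X₀.IsBaseChangeVia Y (Spec.map (CommRingCat.ofHom (Ideal.Quotient.factor h))) G := by
    refine descent_on_principalSmall J₀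
      (Q := fun J => ∀ h : J ≤ J₀, ∃ (Y : AbelianSchemeOver (Spec (.of (A ⧸ J)))) (_ : Y.IsOfRelDim g) (G : X₀.X.left ⟶ Y.X.left),
        X₀.IsBaseChangeVia Y (Spec.map (CommRingCat.ofHom (Ideal.Quotient.factor h))) G)
      (fun h => ⟨X₀, hg, 𝟙 _, isBaseChangeVia_factor_self X₀ h⟩) ?_
    intro J J' t hJJ₀ hJ'J hmJ htJ htJ' hsup hQ hJ'J₀
    obtain ⟨Y₁, hY₁, G₁, h₁⟩ := hQ hJJ₀
    obtain ⟨Y, hY, G₂, h₂⟩ := hstep t hJJ₀ hJ'J hmJ htJ htJ' hsup Y₁ hY₁ G₁ h₁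
    refine ⟨Y, hY, G₁ ≫ G₂, ?_⟩
    have h := h₁.trans h₂
    rwa [← Spec.map_comp, ← CommRingCat.ofHom_comp, factor_comp_factor hJ'J.le hJJ₀] at h
  obtain ⟨Y, hY, G, h⟩ := hbot bot_le
  have hbij : Function.Bijective (Ideal.Quotient.mk (⊥ : Ideal A)) := by
    refine ⟨fun x y hxy => ?_, Ideal.Quotient.mk_surjective⟩
    rw [Ideal.Quotient.eq, Ideal.mem_bot, sub_eq_zero] at hxy
    exact hxy
  haveI : IsIso (Spec.map (CommRingCat.ofHom (Ideal.Quotient.mk (⊥ : Ideal A)))) := by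
    haveI : IsIso (CommRingCat.ofHom (Ideal.Quotient.mk (⊥ : Ideal A))) := by
      rw [show CommRingCat.ofHom (Ideal.Quotient.mk (⊥ : Ideal A)) = (RingEquiv.ofBijective _ hbij).toCommRingCatIso.hom from rfl]
      infer_instance
    infer_instance
  let e : Spec (.of A) ≅ Spec (.of (A ⧸ (⊥ : Ideal A))) := (asIso (Spec.map (CommRingCat.ofHom (Ideal.Quotient.mk (⊥ : Ideal A))))).symm
  have hX := isBaseChangeVia_baseChange_inv Y e
  have hfin := h.trans hX
  rw [show Spec.map (CommRingCat.ofHom (Ideal.Quotient.factor (bot_le : (⊥ : Ideal A) ≤ J₀))) ≫ e.inv =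
      Spec.map (CommRingCat.ofHom (Ideal.Quotient.mk J₀)) by
    rw [Iso.symm_inv, asIso_hom, ← Spec.map_comp, ← CommRingCat.ofHom_comp, Ideal.Quotient.factor_comp_mk]] at hfin
  exact ⟨Y.baseChange e.hom, IsOfRelDim.of_isBaseChangeVia (Y.baseChange_isBaseChangeVia e.hom) hY, _, hfin⟩

/-- **FC-4′ — PER-INSTANCE lifting along `A → A⧸J₀` from the vanishing of the lift obstruction AT THE LIFTS OF `X₀` ONLY.**  As ★ FC-4
`exists_abelianLift_of_liftObstructionVanishes`, but `hvan` is asked only of those `Y₀` over `Spec ((A⧸J′)⧸(J∕J′))` (principal small rung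
`J′ < J ≤ J₀`) that receive a base-change square `G₀ : X₀ → Y₀` over `Spec` of `(A⧸J′)⧸(J∕J′) ≅ A⧸J → A⧸J₀`
(`Ideal.Quotient.factor ∘ DoubleQuot.quotQuotEquivQuotOfLE`). [cite: Oort1971, Theorem (2.2.1) (p. 273), first proof (pp. 279–280)]
[cite: MumfordFogartyKirwan1994, Ch. 6 §3 Proposition 6.15 (p. 124), proof (p. 125)] [cite: StacksProject, Tag 06GE] -/
theorem exists_abelianLift_of_liftObstructionVanishes_of_lifts {A : Type} [CommRing A] [IsArtinianRing A] [IsLocalRing A]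
    (J₀ : Ideal A) (hJ₀ : J₀ ≠ ⊤) {g : ℕ} (X₀ : AbelianSchemeOver (Spec (.of (A ⧸ J₀)))) (hg : X₀.IsOfRelDim g)
    (hvan : ∀ ⦃J J' : Ideal A⦄ (t : A) (hJJ₀ : J ≤ J₀) (hJ'J : J' < J), maximalIdeal A * J ≤ J' → t ∈ J → t ∉ J' →
      J' ⊔ Ideal.span {t} = J →
      ∀ (hI : IsLocalRing (A ⧸ J')) (hL : J.map (Ideal.Quotient.mk J') ≠ ⊤)
        (hmL : maximalIdeal (A ⧸ J') * J.map (Ideal.Quotient.mk J') = ⊥)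
        (φ : ↥(J.map (Ideal.Quotient.mk J')) ≃ₗ[A ⧸ J'] ResidueField (A ⧸ J'))
        (Y₀ : AbelianSchemeOver (Spec (.of ((A ⧸ J') ⧸ J.map (Ideal.Quotient.mk J'))))), Y₀.IsOfRelDim g →
      ∀ (G₀ : X₀.X.left ⟶ Y₀.X.left),
        X₀.IsBaseChangeVia Y₀ (Spec.map (CommRingCat.ofHom ((Ideal.Quotient.factor hJJ₀).comp
          (DoubleQuot.quotQuotEquivQuotOfLE hJ'J.le).toRingHom))) G₀ →
        LiftObstructionVanishes hL hmL φ Y₀)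
    : ∃ (X : AbelianSchemeOver (Spec (.of A))) (_ : X.IsOfRelDim g) (G : X₀.X.left ⟶ X.X.left),
      X₀.IsBaseChangeVia X (Spec.map (CommRingCat.ofHom (Ideal.Quotient.mk J₀))) G := by
  refine exists_abelianLift_of_rungs_of_lifts J₀ X₀ hg (fun J J' t hJJ₀ hJ'J hmJ htJ htJ' hsup Y₀ hY₀ G₀ h₀ => ?_)
  have hJtop : J ≠ ⊤ := fun h => hJ₀ (top_le_iff.mp (h ▸ hJJ₀))
  obtain ⟨hI, hL, hmL, ⟨φ⟩⟩ := principalSmallLine_map_mk hJtop hJ'J hmJ htJ' hsup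
  let e : (A ⧸ J') ⧸ J.map (Ideal.Quotient.mk J') ≃+* A ⧸ J := DoubleQuot.quotQuotEquivQuotOfLE hJ'J.le
  let es : Spec (.of ((A ⧸ J') ⧸ J.map (Ideal.Quotient.mk J'))) ≅ Spec (.of (A ⧸ J)) :=
    Scheme.Spec.mapIso e.symm.toCommRingCatIso.op
  have hY₀' : (Y₀.baseChange es.hom).IsOfRelDim g :=
    IsOfRelDim.of_isBaseChangeVia (Y₀.baseChange_isBaseChangeVia es.hom) hY₀
  -- the square from `X₀` to the transported scheme, over `Spec (factor ∘ e)`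
  have hsq : X₀.IsBaseChangeVia (Y₀.baseChange es.hom)
      (Spec.map (CommRingCat.ofHom ((Ideal.Quotient.factor hJJ₀).comp e.toRingHom)))
      (G₀ ≫ CategoryTheory.inv (pullback.fst Y₀.X.hom es.hom)) := by
    refine IsBaseChangeVia.congr_base ?_ (h₀.trans (isBaseChangeVia_baseChange_inv Y₀ es))
    change Spec.map (CommRingCat.ofHom (Ideal.Quotient.factor hJJ₀)) ≫
        Spec.map (CommRingCat.ofHom (e.symm.symm : (A ⧸ J') ⧸ J.map (Ideal.Quotient.mk J') →+* A ⧸ J)) = _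
    rw [← Spec.map_comp, ← CommRingCat.ofHom_comp]
    rfl
  -- ★ FC-2: the one-step lift of the transported scheme, under the vanishing hypothesis AT THIS LIFT
  obtain ⟨Y, hY, G, hbc⟩ := exists_abelianLift_of_classZero hL hmL φ (Y₀.baseChange es.hom) hY₀'
    (hvan t hJJ₀ hJ'J hmJ htJ htJ' hsup hI hL hmL φ _ hY₀' _ hsq)
  -- transport back and read the base map as `Spec (factor : A⧸J' → A⧸J)` (verbatim FC-4)
  have hbase : es.inv ≫ Spec.map (CommRingCat.ofHom (Ideal.Quotient.mk (J.map (Ideal.Quotient.mk J')))) =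
      Spec.map (CommRingCat.ofHom (Ideal.Quotient.factor hJ'J.le)) := by
    change Spec.map (CommRingCat.ofHom (e.symm.symm : (A ⧸ J') ⧸ J.map (Ideal.Quotient.mk J') →+* A ⧸ J)) ≫ _ = _
    rw [← Spec.map_comp, ← CommRingCat.ofHom_comp]
    congr 2
    exact Ideal.Quotient.ringHom_ext (RingHom.ext fun x => rfl)
  exact ⟨Y, hY, _, IsBaseChangeVia.congr_base hbase ((isBaseChangeVia_baseChange_inv Y₀ es).trans hbc)⟩

/-! ## §B (T) Transport of the `H¹`-count from the closed fibre of `X₀` to the closed fibre of a lift `Y₀` -/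

/-- A quasi-compact scheme has a finite affine open cover indexed in `Type`. [folklore] -/
private theorem exists_finite_isAffineOpen_cover_of_compactSpace (X : Scheme.{0}) [CompactSpace X] :
    ∃ (ι : Type) (_ : Finite ι) (U : ι → X.Opens), (∀ i, IsAffineOpen (U i)) ∧ ⨆ i, U i = ⊤ := by
  obtain ⟨s, hs, e⟩ := (isCompact_iff_finite_and_eq_biUnion_affineOpens (U := (⊤ : X.Opens))).mp
    (by simpa using isCompact_univ)
  haveI := hs.to_subtype
  refine ⟨s, inferInstance, fun i => i.1.1, fun i => i.1.2, ?_⟩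
  rw [iSup_subtype]
  exact e.symm

/-- **The residue points of the rung agree**: `Spec (κ(A) → κ(A⧸J′)) ≫ (Spec κ(A) → Spec (A⧸J₀)) ≫ Spec ((A⧸J′)⧸(J∕J′) ≅ A⧸J → A⧸J₀)`
is the residue point `Spec κ(A⧸J′) → Spec ((A⧸J′)⧸(J∕J′))` (all four ring maps are induced from `A`). [folklore]
[cite: GortzWedhorn2020, Section (4.7) (pp. 107–108)] -/
theorem specMap_residueFieldMap_comp_residueBaseMap_comp {A : Type} [CommRing A] [IsArtinianRing A] [IsLocalRing A]
    {J₀ J J' : Ideal A} (hJ₀ : J₀ ≠ ⊤) (hJJ₀ : J ≤ J₀) (hJ'J : J' ≤ J) [IsLocalRing (A ⧸ J')]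
    (hL : J.map (Ideal.Quotient.mk J') ≠ ⊤) :
    haveI : IsLocalHom (Ideal.Quotient.mk J') := IsLocalHom.of_surjective (Ideal.Quotient.mk J') Ideal.Quotient.mk_surjective
    Spec.map (CommRingCat.ofHom (ResidueField.map (Ideal.Quotient.mk J'))) ≫ residueBaseMap hJ₀ ≫
      Spec.map (CommRingCat.ofHom ((Ideal.Quotient.factor hJJ₀).comp (DoubleQuot.quotQuotEquivQuotOfLE hJ'J).toRingHom)) =
      residueBaseMap hL := by
  haveI : IsLocalHom (Ideal.Quotient.mk J') := IsLocalHom.of_surjective (Ideal.Quotient.mk J') Ideal.Quotient.mk_surjective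
  change Spec.map _ ≫ Spec.map _ ≫ Spec.map _ = Spec.map _
  rw [← Spec.map_comp, ← Spec.map_comp, ← CommRingCat.ofHom_comp, ← CommRingCat.ofHom_comp]
  congr 2
  exact Ideal.Quotient.ringHom_ext (Ideal.Quotient.ringHom_ext (RingHom.ext fun a => rfl))

/-- **(T) TRANSPORT OF THE `H¹`-COUNT ALONG A RUNG.**  `A` Artin local, `J′ ≤ J ≤ J₀ ≠ ⊤`, `L := J∕J′ ≠ ⊤` in the local ring `A⧸J′`; `X₀` abelian of
relative dimension `g` over `Spec (A⧸J₀)`, `Y₀` abelian of relative dimension `g` over `Spec ((A⧸J′)⧸L)` receiving a base-change square `G₀ : X₀ → Y₀` over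
`Spec ((A⧸J′)⧸L ≅ A⧸J → A⧸J₀)`.  IF the canonical closed fibre `X₀ ⊗ κ(A)` satisfies `dim ≤ dim_{κ(A)} Ȟ¹(𝔙, 𝒪) + 1` on every finite affine open cover,
THEN so does the canonical closed fibre `Y₀ ⊗ κ(A⧸J′)` over `κ(A⧸J′)`: the latter is the base change of the former along the (flat) residue-field map
`κ(A) → κ(A⧸J′)` (pullback pasting ∕ cancellation of the three cartesian squares), so [StacksProject] 02KH in degree one (★ `finrank_cechH1_baseChange`),
`finrank_{κ′} (κ′ ⊗_κ M) = finrank_κ M` (Mathlib `Module.finrank_baseChange`), independence of the finite affine cover (★ `finrank_cechH1_eq_of_isAffineOpen`,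
[Hartshorne1977] III Thm. 4.5) and `dim = g` on both fibres (★ `dim_toAffine_toAbelianVariety_of_isOfRelDim`) carry the inequality across.
[cite: StacksProject, Tag 02KH] [cite: Hartshorne1977, III Prop. 9.3 (p. 255) and III Thm. 4.5 (p. 222)] [cite: GortzWedhorn2020, Section (4.7) (pp. 107–108)] -/
theorem closedFibreCount_of_isBaseChangeVia {A : Type} [CommRing A] [IsArtinianRing A] [IsLocalRing A]
    {J₀ J J' : Ideal A} (hJ₀ : J₀ ≠ ⊤) (hJJ₀ : J ≤ J₀) (hJ'J : J' ≤ J) [IsLocalRing (A ⧸ J')]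
    (hL : J.map (Ideal.Quotient.mk J') ≠ ⊤) {g : ℕ}
    (X₀ : AbelianSchemeOver (Spec (.of (A ⧸ J₀)))) (hg : X₀.IsOfRelDim g)
    (Y₀ : AbelianSchemeOver (Spec (.of ((A ⧸ J') ⧸ J.map (Ideal.Quotient.mk J'))))) (hY₀ : Y₀.IsOfRelDim g)
    (G₀ : X₀.X.left ⟶ Y₀.X.left)
    (hsq : X₀.IsBaseChangeVia Y₀ (Spec.map (CommRingCat.ofHom ((Ideal.Quotient.factor hJJ₀).comp
      (DoubleQuot.quotQuotEquivQuotOfLE hJ'J).toRingHom))) G₀)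
    (hH1₀ : ∀ {ι : Type} [Finite ι] (V : ι → (closedFibre hJ₀ X₀).X.left.Opens), (∀ j, IsAffineOpen (V j)) → iSup V = ⊤ →
      (closedFibre hJ₀ X₀).toAffine.toAbelianVariety.dim ≤ Module.finrank (ResidueField A) (CechH1 (closedFibre hJ₀ X₀).X.hom V) + 1)
    {ι : Type} [Finite ι] (V : ι → (closedFibre hL Y₀).X.left.Opens) (hV : ∀ j, IsAffineOpen (V j)) (hVcov : iSup V = ⊤) :
    (closedFibre hL Y₀).toAffine.toAbelianVariety.dim ≤
      Module.finrank (ResidueField (A ⧸ J')) (CechH1 (closedFibre hL Y₀).X.hom V) + 1 := by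
  haveI : IsLocalHom (Ideal.Quotient.mk J') := IsLocalHom.of_surjective (Ideal.Quotient.mk J') Ideal.Quotient.mk_surjective
  -- the residue-field map `θ : κ(A) → κ(A⧸J′)` as an algebra (a field extension, hence flat)
  letI : Algebra (ResidueField A) (ResidueField (A ⧸ J')) := (ResidueField.map (Ideal.Quotient.mk J')).toAlgebra
  have hθalg : algebraMap (ResidueField A) (ResidueField (A ⧸ J')) = ResidueField.map (Ideal.Quotient.mk J') := rfl
  haveI : Module.Flat (ResidueField A) (ResidueField (A ⧸ J')) := inferInstance
  -- the three cartesian squares: closed fibre of `X₀`, the rung square, closed fibre of `Y₀`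
  have HX : IsPullback (closedFibreι hJ₀ X₀) (closedFibre hJ₀ X₀).X.hom X₀.X.hom (residueBaseMap hJ₀) :=
    IsPullback.of_hasPullback X₀.X.hom (residueBaseMap hJ₀)
  have HZ : IsPullback (closedFibreι hL Y₀) (closedFibre hL Y₀).X.hom Y₀.X.hom (residueBaseMap hL) :=
    IsPullback.of_hasPullback Y₀.X.hom (residueBaseMap hL)
  obtain ⟨_, HG, _, _⟩ := hsq
  have Hbig := HX.paste_horiz HG
  have hθ := specMap_residueFieldMap_comp_residueBaseMap_comp hJ₀ hJJ₀ hJ'J hL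
  rw [← hθalg] at hθ
  -- the comparison morphism of closed fibres and its cartesian square over `Spec θ`
  have hw : closedFibreι hL Y₀ ≫ Y₀.X.hom =
      ((closedFibre hL Y₀).X.hom ≫ Spec.map (CommRingCat.ofHom (algebraMap (ResidueField A) (ResidueField (A ⧸ J'))))) ≫
        residueBaseMap hJ₀ ≫ Spec.map (CommRingCat.ofHom ((Ideal.Quotient.factor hJJ₀).comp
          (DoubleQuot.quotQuotEquivQuotOfLE hJ'J).toRingHom)) := by
    rw [Category.assoc, hθ]
    exact HZ.w
  have hγ₁ := Hbig.lift_fst _ _ hw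
  have hγ₂ := Hbig.lift_snd _ _ hw
  have Hγ : IsPullback (Hbig.lift _ _ hw) (closedFibre hL Y₀).X.hom (closedFibre hJ₀ X₀).X.hom
      (Spec.map (CommRingCat.ofHom (algebraMap (ResidueField A) (ResidueField (A ⧸ J'))))) := by
    refine IsPullback.of_right ?_ hγ₂ Hbig
    rw [hγ₁, hθ]
    exact HZ
  -- a finite affine open cover of the closed fibre of `X₀` and its (affine) preimage cover
  haveI := (closedFibre hJ₀ X₀).isProper
  haveI : CompactSpace ↥(closedFibre hJ₀ X₀).X.left := QuasiCompact.compactSpace_of_compactSpace (closedFibre hJ₀ X₀).X.hom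
  haveI : QuasiSeparatedSpace ↥(closedFibre hJ₀ X₀).X.left := quasiSeparatedSpace_of_quasiSeparated (closedFibre hJ₀ X₀).X.hom
  obtain ⟨κ₀, hκ₀, U, hU, hUcov⟩ := exists_finite_isAffineOpen_cover_of_compactSpace (closedFibre hJ₀ X₀).X.left
  haveI := hκ₀
  haveI : IsAffineHom (Hbig.lift _ _ hw) := MorphismProperty.of_isPullback (P := @IsAffineHom) Hγ.flip inferInstance
  have hU' : ∀ i, IsAffineOpen (preimageFamily (Hbig.lift _ _ hw) U i) := fun i => (hU i).preimage _
  have hU'cov : ⨆ i, preimageFamily (Hbig.lift _ _ hw) U i = ⊤ := (Hbig.lift _ _ hw).iSup_preimage_eq_top hUcov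
  -- flat base change in degree one, ranks through the field map, cover independence, and the two dimensions
  have hrk := finrank_cechH1_baseChange (closedFibre hJ₀ X₀).X.hom (closedFibre hL Y₀).X.hom (Hbig.lift _ _ hw) U Hγ hU
  haveI : Module.Free (ResidueField A) (CechH1 (closedFibre hJ₀ X₀).X.hom U) := Module.Free.of_divisionRing _ _
  rw [Module.finrank_baseChange] at hrk
  have hind := finrank_cechH1_eq_of_isAffineOpen (closedFibre hL Y₀).X.hom V (preimageFamily (Hbig.lift _ _ hw) U) hV hU' hVcov hU'cov
  have hdY : (closedFibre hL Y₀).toAffine.toAbelianVariety.dim = g :=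
    dim_toAffine_toAbelianVariety_of_isOfRelDim (hY₀.baseChange (residueBaseMap hL))
  have hdX : (closedFibre hJ₀ X₀).toAffine.toAbelianVariety.dim = g :=
    dim_toAffine_toAbelianVariety_of_isOfRelDim (hg.baseChange (residueBaseMap hJ₀))
  rw [hdY, hind, hrk, ← hdX]
  exact hH1₀ U hU hUcov

/-! ## §C (O8) The per-instance lifting theorems -/

variable {A : Type} [CommRing A] [IsArtinianRing A] [IsLocalRing A]

/-- **(O8a) [Oort1971] Thm. (2.2.1) with `2 ∈ A^×`, PER INSTANCE: the `H¹`-count is needed ONLY for the canonical closed fibre `X₀ ⊗ κ(A)`.**  `A` Artin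
local with `2` a unit, `J₀ ≠ ⊤`, `X₀` abelian of relative dimension `g` over `Spec (A⧸J₀)` whose canonical closed fibre satisfies `dim ≤ dim_{κ(A)} Ȟ¹(𝔙, 𝒪) + 1`
on every finite affine open cover ([MumfordAV1970] §13 Cor. 2 gives `=` without `+ 1`) ⇒ `X₀` lifts to an abelian scheme of relative dimension `g` over
`Spec A` (★ `IsBaseChangeVia`).  FC-4′ ∘ ★ (O6) `liftObstructionVanishes_of_isUnit_two` at every principal small rung, the rung's count being (T)-transported
from `X₀ ⊗ κ(A)`.  [cite: Oort1971, Theorem (2.2.1) (p. 273) and pp. 277–280] [cite: MumfordFogartyKirwan1994, Ch. 6 §3 Proposition 6.15 (p. 124)]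
[cite: MumfordAV1970, §13 Cor. 2 (p. 129)] [cite: StacksProject, Tag 02KH] -/
theorem exists_abelianLift_of_isUnit_two_of_closedFibreCount (J₀ : Ideal A) (hJ₀ : J₀ ≠ ⊤) {g : ℕ} (h2 : IsUnit (2 : A))
    (X₀ : AbelianSchemeOver (Spec (.of (A ⧸ J₀)))) (hg : X₀.IsOfRelDim g)
    (hH1₀ : ∀ {ι : Type} [Finite ι] (V : ι → (closedFibre hJ₀ X₀).X.left.Opens), (∀ j, IsAffineOpen (V j)) → iSup V = ⊤ →
      (closedFibre hJ₀ X₀).toAffine.toAbelianVariety.dim ≤ Module.finrank (ResidueField A) (CechH1 (closedFibre hJ₀ X₀).X.hom V) + 1) :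
    ∃ (X : AbelianSchemeOver (Spec (.of A))) (_ : X.IsOfRelDim g) (G : X₀.X.left ⟶ X.X.left),
      X₀.IsBaseChangeVia X (Spec.map (CommRingCat.ofHom (Ideal.Quotient.mk J₀))) G := by
  refine exists_abelianLift_of_liftObstructionVanishes_of_lifts J₀ hJ₀ X₀ hg
    (fun J J' t hJJ₀ hJ'J _ _ _ _ hI hL hmL φ Y₀ hY₀ G₀ hsq => ?_)
  haveI := hI
  have h2' : IsUnit (2 : A ⧸ J') := by simpa only [map_ofNat] using h2.map (Ideal.Quotient.mk J')
  exact liftObstructionVanishes_of_isUnit_two hL hmL φ Y₀ hY₀ h2'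
    (fun V hV hVcov => closedFibreCount_of_isBaseChangeVia hJ₀ hJJ₀ hJ'J.le hL X₀ hg Y₀ hY₀ G₀ hsq hH1₀ V hV hVcov)

/-- **(O8b) — the same with the count on ONE finite affine open cover of the closed fibre** (independence of the affine cover, ★
`finrank_cechH1_eq_of_isAffineOpen`, [Hartshorne1977] III Thm. 4.5). [cite: Oort1971, Theorem (2.2.1) (p. 273) and pp. 277–280]
[cite: Hartshorne1977, III Thm. 4.5 (p. 222)] [cite: MumfordAV1970, §13 Cor. 2 (p. 129)] -/
theorem exists_abelianLift_of_isUnit_two_of_closedFibreCount_one (J₀ : Ideal A) (hJ₀ : J₀ ≠ ⊤) {g : ℕ} (h2 : IsUnit (2 : A))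
    (X₀ : AbelianSchemeOver (Spec (.of (A ⧸ J₀)))) (hg : X₀.IsOfRelDim g)
    {ι : Type} (V : ι → (closedFibre hJ₀ X₀).X.left.Opens) (hV : ∀ j, IsAffineOpen (V j)) (hVcov : iSup V = ⊤)
    (hcount : g ≤ Module.finrank (ResidueField A) (CechH1 (closedFibre hJ₀ X₀).X.hom V) + 1) :
    ∃ (X : AbelianSchemeOver (Spec (.of A))) (_ : X.IsOfRelDim g) (G : X₀.X.left ⟶ X.X.left),
      X₀.IsBaseChangeVia X (Spec.map (CommRingCat.ofHom (Ideal.Quotient.mk J₀))) G := by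
  refine exists_abelianLift_of_isUnit_two_of_closedFibreCount J₀ hJ₀ h2 X₀ hg (fun W hW hWcov => ?_)
  rw [dim_toAffine_toAbelianVariety_of_isOfRelDim (hg.baseChange (residueBaseMap hJ₀)),
    finrank_cechH1_eq_of_isAffineOpen (closedFibre hJ₀ X₀).X.hom W V hW hV hWcov hVcov]
  exact hcount

end Literature.AlgebraicGeometry.AbelianSchemes.AbelianSchemeOver

end
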